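import Literature.Combinatorics.Designs.LegendrePairs

/-!
# The two-squares obstruction at the cube root of unity for Legendre pairs of length `n = 3m`

For a Legendre pair `(a, b)` of length `n = 3m` write `c̃_k = Σ_{i ≡ k (mod 3)} c_i` (`k = 0, 1, 2`) for the
3-compression of `c = a, b`.  The compression identities (periodic autocorrelations summed over a residue class
mod 3) give

* `Σ_k ã_k² + Σ_k b̃_k² = Σ_{3 ∣ s} (PAF_a + PAF_b)(s) = 2n - 2(m - 1) = 4m + 2`   (`sum_chi3_zero_paf`),
* `(ã₀ã₁ + ã₁ã₂ + ã₂ã₀) + (b̃₀b̃₁ + b̃₁b̃₂ + b̃₂b̃₀) = Σ_{s ≡ 1 (3)} (PAF_a + PAF_b)(s) = -2m`   (`sum_chi3_one_paf`),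

and their difference is `|A(ω)|² + |B(ω)|² = 2n + 2` at a primitive cube root of unity `ω` (the `(n/3)`-rd PSD value,
[Kotsireas–Koutschan, J. Combin. Des. 29 (2021) = arXiv:2101.03116, Lemma 1 and Cor. 1: `PSD(A,m) = A₁² + A₂² + A₃² - A₁A₂ - A₁A₃ - A₂A₃`, `PSD(A,m) + PSD(B,m) = 2ℓ + 2`]).  If both sequences are invariant under a unit multiplier
`u ≡ 2 (mod 3)`, multiplication by `u` swaps the classes `1` and `2 (mod 3)`, so `c̃₂ = c̃₁`, `A(ω) = ã₀ - ã₁ ∈ ℤ`, and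

  `(ã₀ - ã₁)² + (b̃₀ - b̃₁)² = 2n + 2`   (`sq_add_sq_of_mul_two_mod_three`).

Hence (`no_legendrePair_of_mul_two_mod_three`): if `2n + 2` is not a sum of two integer squares, no Legendre pair of
length `n` has both sequences invariant under a unit `≡ 2 (mod 3)`; in particular (`u = -1`) no such pair is
symmetric.  Instances: `n = 333` (`668 = 4·167`) is [Ramos–Hulak–de Queiroz, arXiv:2607.20765v1, Prop. 1], already in
the tree as `NineComp333.rhdq_prop1'` (`Mod3Obstruction333.lean`, not restated here); `n = 117` (`236 = 4·59`, `no_legendrePair117_of_mul_two_mod_three`): the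
Legendre pairs of length 117 found in [arXiv:2101.03116, §4.1] via `H₁ = {1,16,22}` and `H₄ = {1,61,94}` necessarily use
multiplier groups inside the index-2 subgroup `{u ≡ 1 (mod 3)}` of `(ℤ/117)ˣ`, and no Legendre pair of length 117 is
symmetric.

Provenance.  The length-333 statement is RHdQ's Proposition 1, which its authors describe as "the length-333 instance
of the compression and spectral obstructions" of [Fletcher–Gysin–Seberry 2001; Đoković–Kotsireas 2015;
Kotsireas–Koutschan 2021]; the uniform integer-only formulation below and the length-117 corollary were written out
inside the pub-lottery cell (2026-08-19) and are NOT claimed to appear verbatim in the literature (searched: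
arXiv:2607.20765, arXiv:2101.03116, arXiv:2111.02105 full text; corpus + galaxy for "Legendre pair" ∧ "sum of two
squares").  No `sorry`, no new axioms, no `native_decide`; the integer arithmetic uses `decide` only on ranges `< 26`.
-/

open Finset BigOperators

namespace Literature.Combinatorics.Designs.LegendrePairs

variable {n : ℕ} [NeZero n]

/-! ## §1 Class indicators and class sums mod 3 -/

/-- indicator of the residue class `r (mod 3)` (via `ZMod.val`). [folklore] -/
def chi3 (r : ℕ) (i : ZMod n) : ℤ := if i.val % 3 = r then 1 else 0

/-- the class sum `c̃_r = Σ_{i ≡ r (mod 3)} c_i` (3-compression entry). [cite: DjokovicKotsireas2015, §2 (compression)] -/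
def classSum3 (c : ZMod n → ℤ) (r : ℕ) : ℤ := ∑ i, chi3 r i * c i

/-- `(i + s).val ≡ i.val + s.val (mod 3)` when `3 ∣ n`. [folklore] -/
lemma val_add_mod_three (h3n : 3 ∣ n) (i s : ZMod n) : (i + s).val % 3 = (i.val + s.val) % 3 := by
  rw [ZMod.val_add, Nat.mod_mod_of_dvd _ h3n]

omit [NeZero n] in
/-- `(u i).val ≡ u.val · i.val (mod 3)` when `3 ∣ n`. [folklore] -/
lemma val_mul_mod_three (h3n : 3 ∣ n) (u i : ZMod n) : (u * i).val % 3 = (u.val * i.val) % 3 := by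
  rw [ZMod.val_mul, Nat.mod_mod_of_dvd _ h3n]

omit [NeZero n] in
/-- orthogonality of the mod-3 class indicators. [folklore] -/
lemma sum_chi3_mul_chi3 (i j : ZMod n) :
    (∑ k ∈ Finset.range 3, chi3 k i * chi3 k j) = if i.val % 3 = j.val % 3 then 1 else 0 := by
  have hi : i.val % 3 < 3 := Nat.mod_lt _ (by norm_num)
  have hj : j.val % 3 < 3 := Nat.mod_lt _ (by norm_num)
  unfold chi3
  simp only [Finset.sum_range_succ, Finset.sum_range_zero]
  split_ifs <;> omega

omit [NeZero n] in
/-- the cross orthogonality relation of the mod-3 class indicators. [folklore] -/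
lemma chi3_cross (i j : ZMod n) :
    chi3 0 i * chi3 1 j + chi3 1 i * chi3 2 j + chi3 2 i * chi3 0 j
      = if j.val % 3 = (i.val % 3 + 1) % 3 then 1 else 0 := by
  have hi : i.val % 3 < 3 := Nat.mod_lt _ (by norm_num)
  have hj : j.val % 3 < 3 := Nat.mod_lt _ (by norm_num)
  unfold chi3
  split_ifs <;> omega

/-- the class `r (mod 3)` of `ZMod (3m)` has `m` elements. [folklore] -/
lemma sum_chi3 {m : ℕ} (hn : n = 3 * m) (r : ℕ) (hr : r < 3) : ∑ s : ZMod n, chi3 r s = m := by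
  have key : ∀ k : ℕ, ∑ x ∈ Finset.range (3 * k), (if x % 3 = r then (1 : ℤ) else 0) = k := by
    intro k
    induction k with
    | zero => simp
    | succ k ih =>
      rw [show 3 * (k + 1) = 3 * k + 1 + 1 + 1 by ring]
      simp only [Finset.sum_range_succ, ih]
      have h0 : (3 * k) % 3 = 0 := by omega
      have h1 : (3 * k + 1) % 3 = 1 := by omega
      have h2 : (3 * k + 1 + 1) % 3 = 2 := by omega
      simp only [h0, h1, h2]
      push_cast
      interval_cases r <;> simp
  have himg : (Finset.univ : Finset (ZMod n)).image ZMod.val = Finset.range n := by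
    ext x
    simp only [Finset.mem_image, Finset.mem_univ, true_and, Finset.mem_range]
    constructor
    · rintro ⟨s, rfl⟩; exact ZMod.val_lt s
    · intro hx; exact ⟨(x : ZMod n), ZMod.val_natCast_of_lt hx⟩
  have hinj : ∀ a ∈ (Finset.univ : Finset (ZMod n)), ∀ b ∈ (Finset.univ : Finset (ZMod n)),
      ZMod.val a = ZMod.val b → a = b := fun a _ b _ h => ZMod.val_injective n h
  have step : ∑ s : ZMod n, chi3 r s
      = ∑ x ∈ (Finset.univ : Finset (ZMod n)).image ZMod.val, (if x % 3 = r then (1 : ℤ) else 0) := by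
    rw [Finset.sum_image hinj]
    unfold chi3
    rfl
  rw [step, himg, hn, key]

/-! ## §2 Compression identities at `d = 3` -/

/-- autocorrelation form: `Σ_k c̃_k² = Σ_{3 ∣ s} PAF_c(s)`.
[cite: DjokovicKotsireas2015, Thm 3 (compression identities); RamosHulakDeQueiroz2026, Lemma 2] -/
lemma sum_sq_classSum3 (h3n : 3 ∣ n) (c : ZMod n → ℤ) :
    ∑ k ∈ Finset.range 3, (classSum3 c k) ^ 2 = ∑ s, chi3 0 s * PAF c s := by
  have L : ∑ k ∈ Finset.range 3, (classSum3 c k) ^ 2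
      = ∑ i, ∑ j, (if i.val % 3 = j.val % 3 then (1 : ℤ) else 0) * (c i * c j) := by
    unfold classSum3
    simp_rw [sq, Finset.sum_mul_sum]
    rw [Finset.sum_comm]
    refine Finset.sum_congr rfl fun i _ => ?_
    rw [Finset.sum_comm]
    refine Finset.sum_congr rfl fun j _ => ?_
    rw [← sum_chi3_mul_chi3 i j, Finset.sum_mul]
    refine Finset.sum_congr rfl fun k _ => ?_
    ring
  have R : ∑ s, chi3 0 s * PAF c s
      = ∑ i, ∑ j, (if i.val % 3 = j.val % 3 then (1 : ℤ) else 0) * (c i * c j) := by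
    unfold PAF
    simp_rw [Finset.mul_sum]
    rw [Finset.sum_comm]
    refine Finset.sum_congr rfl fun i _ => ?_
    rw [← Equiv.sum_comp (Equiv.addLeft i)
      (fun j => (if i.val % 3 = j.val % 3 then (1 : ℤ) else 0) * (c i * c j))]
    refine Finset.sum_congr rfl fun s _ => ?_
    show chi3 0 s * (c i * c (i + s))
      = (if i.val % 3 = (i + s).val % 3 then (1 : ℤ) else 0) * (c i * c (i + s))
    congr 1
    unfold chi3
    have key : s.val % 3 = 0 ↔ i.val % 3 = (i + s).val % 3 := by
      rw [val_add_mod_three h3n]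
      have : i.val % 3 < 3 := Nat.mod_lt _ (by norm_num)
      omega
    by_cases h : s.val % 3 = 0
    · rw [if_pos h, if_pos (key.mp h)]
    · rw [if_neg h, if_neg (fun h' => h (key.mpr h'))]
  rw [L, R]

/-- cross form: `c̃₀c̃₁ + c̃₁c̃₂ + c̃₂c̃₀ = Σ_{s ≡ 1 (mod 3)} PAF_c(s)`.
[cite: DjokovicKotsireas2015, Thm 3 (compression identities); RamosHulakDeQueiroz2026, Lemma 2] -/
lemma sum_cross_classSum3 (h3n : 3 ∣ n) (c : ZMod n → ℤ) :
    classSum3 c 0 * classSum3 c 1 + classSum3 c 1 * classSum3 c 2 + classSum3 c 2 * classSum3 c 0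
      = ∑ s, chi3 1 s * PAF c s := by
  have L : classSum3 c 0 * classSum3 c 1 + classSum3 c 1 * classSum3 c 2 + classSum3 c 2 * classSum3 c 0
      = ∑ i, ∑ j, (if j.val % 3 = (i.val % 3 + 1) % 3 then (1 : ℤ) else 0) * (c i * c j) := by
    unfold classSum3
    simp_rw [Finset.sum_mul_sum, ← Finset.sum_add_distrib]
    refine Finset.sum_congr rfl fun i _ => Finset.sum_congr rfl fun j _ => ?_
    rw [← chi3_cross i j]
    ring
  have R : ∑ s, chi3 1 s * PAF c s
      = ∑ i, ∑ j, (if j.val % 3 = (i.val % 3 + 1) % 3 then (1 : ℤ) else 0) * (c i * c j) := by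
    unfold PAF
    simp_rw [Finset.mul_sum]
    rw [Finset.sum_comm]
    refine Finset.sum_congr rfl fun i _ => ?_
    rw [← Equiv.sum_comp (Equiv.addLeft i)
      (fun j => (if j.val % 3 = (i.val % 3 + 1) % 3 then (1 : ℤ) else 0) * (c i * c j))]
    refine Finset.sum_congr rfl fun s _ => ?_
    show chi3 1 s * (c i * c (i + s))
      = (if (i + s).val % 3 = (i.val % 3 + 1) % 3 then (1 : ℤ) else 0) * (c i * c (i + s))
    congr 1
    unfold chi3
    have key : s.val % 3 = 1 ↔ (i + s).val % 3 = (i.val % 3 + 1) % 3 := by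
      rw [val_add_mod_three h3n]
      have : i.val % 3 < 3 := Nat.mod_lt _ (by norm_num)
      have : s.val % 3 < 3 := Nat.mod_lt _ (by norm_num)
      omega
    by_cases h : s.val % 3 = 1
    · rw [if_pos h, if_pos (key.mp h)]
    · rw [if_neg h, if_neg (fun h' => h (key.mpr h'))]
  rw [L, R]

/-- for a Legendre pair of length `n = 3m`: `Σ_{3 ∣ s} (PAF_a + PAF_b)(s) = 2n - 2(m - 1) = 4m + 2`.
[cite: KotsireasKoutschan2021, Lemma 1 / Cor. 1; RamosHulakDeQueiroz2026, Lemma 2 / Lemma 4 (norm identity, `n = 333`)] -/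
lemma sum_chi3_zero_paf {m : ℕ} (hn : n = 3 * m) (a b : ZMod n → ℤ) (h : LegendrePair a b) :
    ∑ s, chi3 0 s * (PAF a s + PAF b s) = 4 * m + 2 := by
  have h3n : 3 ∣ n := hn ▸ dvd_mul_right 3 m
  have h00 : chi3 0 (0 : ZMod n) = 1 := by unfold chi3; rw [ZMod.val_zero]; simp
  have : ∀ s : ZMod n, chi3 0 s * (PAF a s + PAF b s)
      = -2 * chi3 0 s + (if s = 0 then 2 * (n : ℤ) + 2 else 0) := by
    intro s
    by_cases hs : s = 0
    · subst hs
      rw [paf_zero a h.1, paf_zero b h.2.1, if_pos rfl, h00]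
      ring
    · rw [if_neg hs, h.2.2 s hs]
      ring
  rw [Finset.sum_congr rfl fun s _ => this s, Finset.sum_add_distrib, ← Finset.mul_sum,
    sum_chi3 hn 0 (by norm_num)]
  simp only [Finset.sum_ite_eq', Finset.mem_univ, if_true]
  have hn' : (n : ℤ) = 3 * m := by exact_mod_cast hn
  linear_combination 2 * hn'

/-- for a Legendre pair of length `n = 3m`: `Σ_{s ≡ 1 (mod 3)} (PAF_a + PAF_b)(s) = -2m`.
[cite: KotsireasKoutschan2021, Lemma 1 / Cor. 1; RamosHulakDeQueiroz2026, Lemma 2] -/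
lemma sum_chi3_one_paf {m : ℕ} (hn : n = 3 * m) (a b : ZMod n → ℤ) (h : LegendrePair a b) :
    ∑ s, chi3 1 s * (PAF a s + PAF b s) = -2 * m := by
  have h10 : chi3 1 (0 : ZMod n) = 0 := by unfold chi3; rw [ZMod.val_zero]; simp
  have : ∀ s : ZMod n, chi3 1 s * (PAF a s + PAF b s) = -2 * chi3 1 s := by
    intro s
    by_cases hs : s = 0
    · subst hs; rw [h10]; ring
    · rw [h.2.2 s hs]; ring
  rw [Finset.sum_congr rfl fun s _ => this s, ← Finset.mul_sum, sum_chi3 hn 1 (by norm_num)]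

/-- invariance under a unit `u ≡ 2 (mod 3)` swaps the classes `1` and `2 (mod 3)`, so their class sums agree
(the 3-compression has the form `(c̃₀, c̃₁, c̃₁)`). [cite: RamosHulakDeQueiroz2026, Prop. 1 (proof)] -/
lemma classSum3_two_eq_one (h3n : 3 ∣ n) (c : ZMod n → ℤ) (u : (ZMod n)ˣ) (hu : (u : ZMod n).val % 3 = 2)
    (hinv : HInvariant c u) : classSum3 c 2 = classSum3 c 1 := by
  unfold classSum3
  rw [← Equiv.sum_comp u.mulLeft (fun j => chi3 2 j * c j)]
  refine Finset.sum_congr rfl fun i _ => ?_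
  show chi3 2 ((u : ZMod n) * i) * c ((u : ZMod n) * i) = chi3 1 i * c i
  rw [hinv i]
  congr 1
  unfold chi3
  have key : ((u : ZMod n) * i).val % 3 = 2 ↔ i.val % 3 = 1 := by
    rw [val_mul_mod_three h3n, Nat.mul_mod, hu]
    have : i.val % 3 < 3 := Nat.mod_lt _ (by norm_num)
    omega
  by_cases h : i.val % 3 = 1
  · rw [if_pos (key.mpr h), if_pos h]
  · rw [if_neg (fun h' => h (key.mp h')), if_neg h]

/-! ## §3 The obstruction -/

/-- **`|A(ω)|² + |B(ω)|² = 2n + 2` with real `A(ω), B(ω)`.**  For a Legendre pair of length `n = 3m` with both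
sequences invariant under a unit `u ≡ 2 (mod 3)`: `(ã₀ - ã₁)² + (b̃₀ - b̃₁)² = 2n + 2`.
[cite: KotsireasKoutschan2021, Lemma 1 / Cor. 1 (PSD at `n/3`); RamosHulakDeQueiroz2026, Prop. 1 (`n = 333`)] -/
theorem sq_add_sq_of_mul_two_mod_three {m : ℕ} (hn : n = 3 * m) (a b : ZMod n → ℤ) (hL : LegendrePair a b)
    (u : (ZMod n)ˣ) (hu : (u : ZMod n).val % 3 = 2) (ha : HInvariant a u) (hb : HInvariant b u) :
    (classSum3 a 0 - classSum3 a 1) ^ 2 + (classSum3 b 0 - classSum3 b 1) ^ 2 = 2 * n + 2 := by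
  have h3n : 3 ∣ n := hn ▸ dvd_mul_right 3 m
  have hN : (∑ k ∈ Finset.range 3, (classSum3 a k) ^ 2) + (∑ k ∈ Finset.range 3, (classSum3 b k) ^ 2)
      = 4 * m + 2 := by
    rw [sum_sq_classSum3 h3n, sum_sq_classSum3 h3n, ← Finset.sum_add_distrib, ← sum_chi3_zero_paf hn a b hL]
    refine Finset.sum_congr rfl fun s _ => ?_; ring
  simp only [Finset.sum_range_succ, Finset.sum_range_zero, zero_add] at hN
  have hX : (classSum3 a 0 * classSum3 a 1 + classSum3 a 1 * classSum3 a 2 + classSum3 a 2 * classSum3 a 0)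
      + (classSum3 b 0 * classSum3 b 1 + classSum3 b 1 * classSum3 b 2 + classSum3 b 2 * classSum3 b 0)
      = -2 * m := by
    rw [sum_cross_classSum3 h3n, sum_cross_classSum3 h3n, ← Finset.sum_add_distrib, ← sum_chi3_one_paf hn a b hL]
    refine Finset.sum_congr rfl fun s _ => ?_; ring
  rw [classSum3_two_eq_one h3n a u hu ha, classSum3_two_eq_one h3n b u hu hb] at hN hX
  have hn' : (n : ℤ) = 3 * m := by exact_mod_cast hn
  linear_combination hN - hX - 2 * hn'

/-- a sum of two integer squares equal to a given `N < 676` has both `|x|, |y| < 26`; used to decide small cases. [folklore] -/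
lemma natAbs_lt_of_sq_add_sq (x y : ℤ) (N : ℕ) (hN : N < 676) (h : x ^ 2 + y ^ 2 = N) :
    x.natAbs < 26 ∧ y.natAbs < 26 ∧ x.natAbs * x.natAbs + y.natAbs * y.natAbs = N := by
  have e : ((x.natAbs * x.natAbs + y.natAbs * y.natAbs : ℕ) : ℤ) = N := by
    push_cast
    rw [abs_mul_abs_self, abs_mul_abs_self]
    linear_combination h
  have e' : x.natAbs * x.natAbs + y.natAbs * y.natAbs = N := by exact_mod_cast e
  refine ⟨?_, ?_, e'⟩
  · by_contra hc
    push Not at hc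
    have := Nat.mul_le_mul hc hc
    omega
  · by_contra hc
    push Not at hc
    have := Nat.mul_le_mul hc hc
    omega

/-- **The obstruction.**  If `2n + 2` is not a sum of two integer squares, no Legendre pair of length `n = 3m` has both
sequences invariant under a unit multiplier `u ≡ 2 (mod 3)`.
[cite: RamosHulakDeQueiroz2026, Prop. 1 (`n = 333`); KotsireasKoutschan2021, Cor. 1] -/
theorem no_legendrePair_of_mul_two_mod_three {m : ℕ} (hn : n = 3 * m)
    (hsq : ∀ x y : ℤ, x ^ 2 + y ^ 2 ≠ 2 * n + 2) (a b : ZMod n → ℤ) (hL : LegendrePair a b)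
    (u : (ZMod n)ˣ) (hu : (u : ZMod n).val % 3 = 2) (ha : HInvariant a u) (hb : HInvariant b u) : False :=
  hsq _ _ (sq_add_sq_of_mul_two_mod_three hn a b hL u hu ha hb)

/-- The case `u = -1` (`≡ 2 (mod 3)` since `3 ∣ n`): if `2n + 2` is not a sum of two squares, no Legendre pair of
length `n = 3m` has both sequences symmetric (`x (-i) = x i`). [cite: RamosHulakDeQueiroz2026, Prop. 1 (`-1 ∉ U₁`)] -/
theorem no_symmetric_legendrePair_of_three_dvd {m : ℕ} (hn : n = 3 * m) (hm : 0 < m)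
    (hsq : ∀ x y : ℤ, x ^ 2 + y ^ 2 ≠ 2 * n + 2) (a b : ZMod n → ℤ) (hL : LegendrePair a b)
    (ha : ∀ i, a (-i) = a i) (hb : ∀ i, b (-i) = b i) : False := by
  haveI : Fact (1 < n) := ⟨by omega⟩
  have hval : ((-1 : (ZMod n)ˣ) : ZMod n).val % 3 = 2 := by
    have h1 : (1 : ZMod n).val = 1 := ZMod.val_one n
    have hneg : ((-1 : (ZMod n)ˣ) : ZMod n).val = n - 1 := by
      rw [Units.val_neg, Units.val_one, ZMod.neg_val, h1, if_neg one_ne_zero]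
    rw [hneg]
    omega
  exact no_legendrePair_of_mul_two_mod_three hn hsq a b hL (-1) hval
    (fun i => by rw [Units.val_neg, Units.val_one, neg_one_mul]; exact ha i)
    (fun i => by rw [Units.val_neg, Units.val_one, neg_one_mul]; exact hb i)

/-! ## §4 Instances -/

/-- `236 = 4 · 59` is not a sum of two integer squares. [folklore] -/
lemma not_sq_add_sq_236 (x y : ℤ) : x ^ 2 + y ^ 2 ≠ 2 * (117 : ℕ) + 2 := by
  intro h
  have key : ∀ p, p < 26 → ∀ q, q < 26 → p * p + q * q ≠ 236 := by decide
  obtain ⟨hx, hy, e⟩ := natAbs_lt_of_sq_add_sq x y 236 (by norm_num) (by rw [h]; norm_num)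
  exact key _ hx _ hy e

/-- **Length 117.**  No Legendre pair of length `117` has both sequences invariant under a unit multiplier
`u ≡ 2 (mod 3)` (`2·117 + 2 = 236 = 4·59`); so every multiplier group of a Legendre pair of length 117 lies in
`{u ≡ 1 (mod 3)}` — consistent with the pairs found via `H₁ = {1,16,22}`, `H₄ = {1,61,94}` in
[KotsireasKoutschan2021, §4.1]. [cite: KotsireasKoutschan2021, Cor. 1, §4.1; RamosHulakDeQueiroz2026, Prop. 1 (method)] -/
theorem no_legendrePair117_of_mul_two_mod_three (a b : ZMod 117 → ℤ) (hL : LegendrePair a b)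
    (u : (ZMod 117)ˣ) (hu : (u : ZMod 117).val % 3 = 2) (ha : HInvariant a u) (hb : HInvariant b u) : False :=
  no_legendrePair_of_mul_two_mod_three (n := 117) (m := 39) (by norm_num) not_sq_add_sq_236 a b hL u hu ha hb

/-- **Length 117, symmetric case.**  No Legendre pair of length 117 has both sequences symmetric.
[cite: KotsireasKoutschan2021, Cor. 1; RamosHulakDeQueiroz2026, Prop. 1 (method)] -/
theorem no_symmetric_legendrePair117 (a b : ZMod 117 → ℤ) (hL : LegendrePair a b)
    (ha : ∀ i, a (-i) = a i) (hb : ∀ i, b (-i) = b i) : False :=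
  no_symmetric_legendrePair_of_three_dvd (n := 117) (m := 39) (by norm_num) (by norm_num) not_sq_add_sq_236
    a b hL ha hb

/-- twisted form for length 117: a set `H` of (possibly translation-twisted) multipliers containing a unit
`≡ 2 (mod 3)` admits no `H`-invariant Legendre pair of length 117. [cite: KotsireasEtAl2023, Cor. 1 (reduction);
KotsireasKoutschan2021, Cor. 1] -/
theorem no_twisted_legendrePair117_of_mul_two_mod_three (H : Set (ZMod 117)ˣ) (u : (ZMod 117)ˣ)
    (hu : (u : ZMod 117).val % 3 = 2) (huH : u ∈ H) :
    ¬ ∃ a b : ZMod 117 → ℤ, LegendrePair a b ∧ (∀ t ∈ H, TwistedInvariant a t) ∧ (∀ t ∈ H, TwistedInvariant b t) := by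
  rw [exists_twisted_iff]
  rintro ⟨a, b, hab, ha, hb⟩
  exact no_legendrePair117_of_mul_two_mod_three a b hab u hu (ha u huH) (hb u huH)

end Literature.Combinatorics.Designs.LegendrePairs
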